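import Literature.NumberTheory.PAdicHodge.AinfWeierstrassEtaPeriodHom
import Literature.NumberTheory.PAdicHodge.AinfWeierstrassPeriodsBounded
import Literature.NumberTheory.PAdicHodge.BdRPlusLatticeSeparated
import HarnessLib

/-!
# `ℤ_p`-linearity of the period maps `∫ω, ∫η : T_pŴ(𝒪_{ℂ_F}) → B_dR⁺(F)`

Topic `Literature/NumberTheory/PAdicHodge`; THEOREMS ONLY. An additive map `φ : M → B_dR⁺(F)` on a `ℤ_p`-module `M` which is
BOUNDED modulo every `Fil^k` in Fontaine's topology (`D_k·φ(M) ⊆ ι(𝔸_inf) + ξ^k B_dR⁺` for some nonzero integer `D_k`) is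
automatically `ℤ_p`-linear for the embedding `ℤ_p ⊂ 𝔸_inf → B_dR⁺`: writing `a = a_N + p^N c` (`a_N ∈ ℕ`, Mathlib `PadicInt.appr`),
`φ(a·m) − ι(a)φ(m) = p^N (φ(c·m) − ι(c)φ(m))` lies, after multiplication by `D_k`, in the lattice `p^N ι(𝔸_inf) + ξ^k B_dR⁺` for every
`N`, hence in `ξ^k B_dR⁺` (`BdRPlusLatticeSeparated`), for every `k`, hence is `0` (`B_dR⁺` is `ξ`-adically separated).

* §1 `BdRPlusTop.map_smul_eq_of_bounded` — the abstract statement for `φ : M →+ BdRPlusTop F p`;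
* §2 **`omegaPeriodHom_smul : ∫_{a·τ} ω = ι(a)·∫_τ ω`** and **`etaPeriodHom_smul : ∫_{a·τ} η = ι(a)·∫_τ η`** for `a ∈ ℤ_p`,
  `τ ∈ TatePt F p W = T_pŴ(𝒪_{ℂ_F})` (boundedness from `AinfWeierstrassPeriodsBounded`: `k!·∫ω, k!·∫η ∈ ι(𝔸_inf) + Fil^k`).

So `τ ↦ (∫_τ ω, ∫_τ η)` are `ℤ_p`-linear `Γ_F`-equivariant maps `T_pŴ → B_dR⁺`, i.e. elements of `Hom_{ℤ_p[Γ_F]}(T_pŴ, B_dR⁺) =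
D_dR(V_pŴ^∨)`; with `∫ω ∈ Fil¹`, `∫η ∉ Fil¹` (under `h₁`) they are the two de Rham periods (Colmez 1992 §2). BSD context: crux K★
`stmt-BirchSwinnertonDyer-22226`, hDR sector (iii) road (A), step (E0c). BSD is not proved by any of this.

## References
* J.-M. Fontaine, *Le corps des périodes p-adiques*, Astérisque 223 (1994), Exp. II §1.5.3–1.5.5. [FontaineAsterisque223III]
* P. Colmez, *Périodes p-adiques des variétés abéliennes*, Math. Ann. 292 (1992), §2. [Colmez1992PeriodesAbeliennes]
-/

noncomputable section

open Ideal Filter Topology Field WittVector MvPowerSeries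

namespace Literature.NumberTheory.PAdicHodge

open Literature.NumberTheory.GaloisRepresentations
open Literature.NumberTheory.GaloisRepresentations.IsNonarchimedeanLocalField
open Literature.NumberTheory.GaloisRepresentations.LubinTate
open Literature.NumberTheory.EllipticCurves

/-! ## §1 Bounded additive maps into `B_dR⁺` are `ℤ_p`-linear -/

namespace BdRPlusTop

variable {F : Type} [Field F] [ValuativeRel F] [TopologicalSpace F] [IsNonarchimedeanLocalField F] [CharZero F]
  {p : ℕ} [Fact p.Prime] [Fact (¬ IsUnit (p : integerC F))]
  [IsAdicComplete (Ideal.span {(p : integerC F)}) (integerC F)]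

omit [CharZero F] in
/-- A nonzero integer is a unit of `B_dR⁺` (a `ℚ`-algebra). [folklore] -/
private theorem isUnit_intCast {D : ℤ} (hD : D ≠ 0) : IsUnit ((D : BdRPlusTop F p)) := by
  have h1 : IsUnit ((D : ℚ)) := isUnit_iff_ne_zero.2 (Int.cast_ne_zero.2 hD)
  have h2 := (h1.map RatCoeff.of.toRingHom).map (algebraMap RatCoeff (BdRPlusTop F p))
  rwa [map_intCast, map_intCast] at h2

/-- An element of `B_dR⁺` a nonzero-integer multiple of which lies in every lattice `p^N ι(𝔸_inf) + Fil^k` (the integer depending on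
`k`) is `0`. [cite: FontaineAsterisque223III, Exp. II §1.5.5] -/
theorem eq_zero_of_forall_int_mul_lattice {x : BdRPlusTop F p}
    (h : ∀ k : ℕ, ∃ D : ℤ, D ≠ 0 ∧ ∀ N : ℕ, ∃ (a : Ainf (p := p) F) (w : BdRPlusTop F p),
      (D : BdRPlusTop F p) * x = ofAinf F p ((p : Ainf (p := p) F) ^ N * a) + of F p xiBdR ^ k * w) : x = 0 := by
  refine eq_zero_of_forall_lattice fun k N => ?_
  obtain ⟨D, hD, hN⟩ := h k
  have hx : x ∈ ((filOne F p).toIdeal ^ k : Ideal (BdRPlusTop F p)) :=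
    (Ideal.unit_mul_mem_iff_mem _ (isUnit_intCast hD)).1 (mem_filOne_pow_of_forall_lattice hN)
  rw [show (filOne F p).toIdeal = (WithIdeal.i : Ideal (BdRPlusTop F p)) from rfl, ideal_eq, Ideal.span_singleton_pow,
    Ideal.mem_span_singleton'] at hx
  obtain ⟨w, hw⟩ := hx
  exact ⟨0, w, by rw [mul_zero, map_zero, zero_add, mul_comm, hw]⟩

/-- **Bounded additive maps into `B_dR⁺` are `ℤ_p`-linear**: if `φ : M →+ B_dR⁺` satisfies `D_k·φ(M) ⊆ ι(𝔸_inf) + Fil^k` with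
`D_k ∈ ℤ ∖ 0` for every `k`, then `φ(a·m) = ι(a)·φ(m)` for all `a ∈ ℤ_p`. [cite: FontaineAsterisque223III, Exp. II §1.5.3–1.5.5]
[cite: Colmez1992PeriodesAbeliennes, §2] -/
theorem map_smul_eq_of_bounded {M : Type*} [AddCommGroup M] [Module ℤ_[p] M] (φ : M →+ BdRPlusTop F p)
    (hφ : ∀ k : ℕ, ∃ D : ℤ, D ≠ 0 ∧ ∀ m : M, ∃ (b : Ainf (p := p) F) (w : BdRPlusTop F p),
      (D : BdRPlusTop F p) * φ m = ofAinf F p b + of F p xiBdR ^ k * w)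
    (a : ℤ_[p]) (m : M) : φ (a • m) = ofAinf F p (zpToAinf a) * φ m := by
  rw [← sub_eq_zero]
  refine eq_zero_of_forall_int_mul_lattice fun k => ?_
  obtain ⟨D, hD, hb⟩ := hφ k
  refine ⟨D, hD, fun N => ?_⟩
  -- `a = r + p^N c` with `r = appr a N ∈ ℕ`
  obtain ⟨c, hc⟩ := Ideal.mem_span_singleton'.1 (PadicInt.appr_spec N a)
  obtain ⟨r, hr⟩ : ∃ r : ℕ, a.appr N = r := ⟨_, rfl⟩
  rw [hr] at hc
  have ha : a = (r : ℤ_[p]) + (p : ℤ_[p]) ^ N * c := by rw [mul_comm, hc]; ring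
  have hsmul : a • m = r • m + p ^ N • (c • m) := by
    rw [ha, add_smul, Nat.cast_smul_eq_nsmul, mul_smul, ← Nat.cast_pow, Nat.cast_smul_eq_nsmul]
  have hι : ofAinf F p (zpToAinf a) = (r : BdRPlusTop F p) + (p : BdRPlusTop F p) ^ N * ofAinf F p (zpToAinf c) := by
    rw [ha, map_add, map_mul, map_pow, map_natCast, map_natCast, map_add, map_mul, map_pow, map_natCast, map_natCast]
  obtain ⟨b₁, w₁, h₁⟩ := hb (c • m)
  obtain ⟨b₂, w₂, h₂⟩ := hb m
  refine ⟨b₁ - zpToAinf c * b₂, (p : BdRPlusTop F p) ^ N * (w₁ - ofAinf F p (zpToAinf c) * w₂), ?_⟩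
  have key : (D : BdRPlusTop F p) * (φ (a • m) - ofAinf F p (zpToAinf a) * φ m) =
      (p : BdRPlusTop F p) ^ N * ((D : BdRPlusTop F p) * φ (c • m) - ofAinf F p (zpToAinf c) * ((D : BdRPlusTop F p) * φ m)) := by
    rw [hsmul, map_add, map_nsmul, map_nsmul, hι, nsmul_eq_mul, nsmul_eq_mul, Nat.cast_pow]
    ring
  rw [key, h₁, h₂]
  simp only [map_mul, map_sub, map_pow, map_natCast]
  ring

end BdRPlusTop

/-! ## §2 The periods of `Ŵ` are `ℤ_p`-linear -/

namespace AinfTop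

variable {F : Type} [Field F] [ValuativeRel F] [TopologicalSpace F] [IsNonarchimedeanLocalField F]
  {p : ℕ} [Fact p.Prime] [Fact (¬ IsUnit (p : integerC F))]
  [IsAdicComplete (Ideal.span {(p : integerC F)}) (integerC F)] [CharZero F]
  {hθ : Function.Surjective (fontaineTheta (integerC F) p)}
  (W : WeierstrassCurve ℤ)

/-- **`ℤ_p`-linearity of the ω-period: `∫_{a·τ} ω = ι(a)·∫_τ ω`** (`a ∈ ℤ_p`). [cite: Colmez1992PeriodesAbeliennes, §2]
[cite: FontaineAsterisque223III, Exp. II §1.5.4] -/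
theorem omegaPeriodHom_smul (a : ℤ_[p]) (τ : TatePt F p W) :
    omegaPeriodHom W hθ (a • τ) = BdRPlusTop.ofAinf F p (zpToAinf a) * omegaPeriodHom W hθ τ :=
  BdRPlusTop.map_smul_eq_of_bounded (omegaPeriodHom W hθ)
    (fun k => ⟨(k.factorial : ℤ), by exact_mod_cast k.factorial_ne_zero, fun τ' => by
      rw [omegaPeriodHom_apply]
      exact omegaPeriod_bounded W k (seq_zero W τ') (mulPC_seq W τ')⟩) a τ

/-- **`ℤ_p`-linearity of the η-period: `∫_{a·τ} η = ι(a)·∫_τ η`** (`a ∈ ℤ_p`). [cite: Colmez1992PeriodesAbeliennes, §2]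
[cite: FontaineAsterisque223III, Exp. II §1.5.4] -/
theorem etaPeriodHom_smul (a : ℤ_[p]) (τ : TatePt F p W) :
    etaPeriodHom W hθ (a • τ) = BdRPlusTop.ofAinf F p (zpToAinf a) * etaPeriodHom W hθ τ :=
  BdRPlusTop.map_smul_eq_of_bounded (etaPeriodHom W hθ)
    (fun k => ⟨(k.factorial : ℤ), by exact_mod_cast k.factorial_ne_zero, fun τ' => by
      rw [etaPeriodHom_apply]
      exact etaPeriod_bounded W k (seq_zero W τ') (mulPC_seq W τ')⟩) a τ

/-- The same with the scalar read through `ℚ_p → B_dR⁺` (tree `qpToBdR`). [cite: Colmez1992PeriodesAbeliennes, §2] -/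
theorem omegaPeriodHom_smul' (a : ℤ_[p]) (τ : TatePt F p W) :
    omegaPeriodHom W hθ (a • τ) = BdRPlusTop.of F p (qpToBdR (a : ℚ_[p])) * omegaPeriodHom W hθ τ := by
  rw [omegaPeriodHom_smul, qpToBdR_coe]
  rfl

/-- The same with the scalar read through `ℚ_p → B_dR⁺`. [cite: Colmez1992PeriodesAbeliennes, §2] -/
theorem etaPeriodHom_smul' (a : ℤ_[p]) (τ : TatePt F p W) :
    etaPeriodHom W hθ (a • τ) = BdRPlusTop.of F p (qpToBdR (a : ℚ_[p])) * etaPeriodHom W hθ τ := by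
  rw [etaPeriodHom_smul, qpToBdR_coe]
  rfl

end AinfTop

end Literature.NumberTheory.PAdicHodge

end
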